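import Summits.RiemannHypothesis.RiemannHypothesis.Theorems.WeilFormatCPolyWindowMixedRegroup
import Summits.RiemannHypothesis.RiemannHypothesis.Theorems.WeilFormatCWindowPolyProfile
import HarnessLib

/-!
# Format C, design C∞: the LOW profile tables `V^±_j(n)` (`n ≤ B`) of polynomial profiles in closed form

Route context: Fourier–Galerkin / Schur-complement certificates of Weil positivity on a window ("format C", C∞ door;
cell memo `run/shared/lean/pub/rh-explicit/rh-explicit-weil-10/KERNEL-LEVER.md` §21 / CINF-E2-CHECKLIST; supporting
stmt-RiemannHypothesis-0098; seat rh-explicit-weil-10).  The margins (`hS_even/odd_of_entries`) and the image coefficient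
matrices of `cinf_hUq_even/odd` use the profile tables at the LOW modes `n ≤ B` as plain numbers.  For polynomial profiles
these are finite closed forms (no series; the flat-monomial lemmas of `WeilFormatCCinfVTable` are repeated as
`private` local copies because that module has no hub olean at filing time):

* `fourierCoeff_zero_pow` — `ĉ_0(x^q) = (a^{q+1} − (−a)^{q+1})/(q+1)`;
* `evenVTable_zero` — `V⁺_f(0) = Re ĉ_0(1f)/√(2a) = (Σ_q c_q (a^{q+1} − (−a)^{q+1})/(q+1))/√(2a)`;
* `evenVTable_low` — `V⁺_f(n) = 2(Σ_q c_q (−1)^n Σ_{k≤q} [(−1)^k q^{(k)}(a^{q−k} − (−a)^{q−k})(a/π)^{k+1}Re(i^{k+1})]/n^{k+1})/√(2a)` (`n ≠ 0`);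
* `oddVTable_low` — `V⁻_f(k) = 2 Im ĉ_{k+1}(1f)/√(2a)` likewise with `Im(i^{k+1})` at the mode `k+1`.

Elementary; standard axioms; no definitions; no RH claim.
-/

set_option autoImplicit false
-- `Summit.RiemannHypothesis.RiemannHypothesis.…` is the layout-mandated namespace (summit = problem name).
set_option linter.dupNamespace false

noncomputable section

open Complex Filter Set MeasureTheory Finset
open scoped Real Topology ComplexConjugate

namespace Summit.RiemannHypothesis.RiemannHypothesis.Theorems.WeilFormatC

open Literature.NumberTheory.LFunctions Literature.NumberTheory.LFunctions.Yoshida1992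

variable {a : ℝ}

/-! ## Window coefficients of the monomials (local copies; `WeilFormatCCinfVTable` has no hub olean at filing time) -/

/-- Local copy (the landed `fourierCoeff_pow_nat` of `WeilFormatCCinfVTable`, p387529, has no hub olean yet):
`ĉ_m(x^q)` for a natural mode `m ≠ 0` as a flat monomial sum (complex form). -/
private theorem fourierCoeff_pow_nat_loc (ha : a ≠ 0) {m : ℕ} (hm : m ≠ 0) (q : ℕ) :
    Yoshida1992.fourierCoeff a m (fun x : ℝ ↦ ((x : ℂ)) ^ q)
      = (-1 : ℂ) ^ m * ∑ k ∈ Finset.range (q + 1),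
          (((-1 : ℝ) ^ k * (q.descFactorial k : ℝ) * (a ^ (q - k) - (-a) ^ (q - k)) * (a / π) ^ (k + 1)
              / (m : ℝ) ^ (k + 1) : ℝ) : ℂ) * I ^ (k + 1) := by
  have hmz : (m : ℤ) ≠ 0 := by exact_mod_cast hm
  have hmr : (m : ℝ) ≠ 0 := by exact_mod_cast hm
  have h := fourierCoeff_ofReal_pow_eq_sum ha hmz q
  rw [zpow_natCast] at h
  rw [h]
  congr 1
  refine Finset.sum_congr rfl fun k _ ↦ ?_
  have hbase : (I * (π * ((-(m : ℤ) : ℤ) : ℝ) / a : ℝ) : ℂ) = -(I * (π * ((m : ℤ) : ℝ) / a : ℝ)) := by push_cast; ring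
  rw [hbase, div_eq_mul_one_div, inv_negI_freq_pow ha hmz k, mul_pow, Int.cast_natCast,
    show (a / (π * m) : ℝ) = (a / π) / m by rw [div_div], Complex.ofReal_div, div_pow]
  push_cast
  ring

/-- Local copy of `re_fourierCoeff_pow_nat` (`WeilFormatCCinfVTable`): **`Re ĉ_m(x^q)` as flat monomials** (`a ≠ 0`, natural `m ≠ 0`):
`Re ĉ_m(x^q) = (−1)^m Σ_{k≤q} [(−1)^k q^{(k)}(a^{q−k} − (−a)^{q−k})(a/π)^{k+1}Re(i^{k+1})]/m^{k+1}`. -/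
private theorem re_fourierCoeff_pow_nat_loc (ha : a ≠ 0) {m : ℕ} (hm : m ≠ 0) (q : ℕ) :
    (Yoshida1992.fourierCoeff a m (fun x : ℝ ↦ ((x : ℂ)) ^ q)).re
      = (-1 : ℝ) ^ m * ∑ k ∈ Finset.range (q + 1),
          ((-1 : ℝ) ^ k * (q.descFactorial k : ℝ) * (a ^ (q - k) - (-a) ^ (q - k)) * (a / π) ^ (k + 1)
            * (I ^ (k + 1)).re) / (m : ℝ) ^ (k + 1) := by
  rw [fourierCoeff_pow_nat_loc ha hm q]
  have hsgn : ((-1 : ℂ)) ^ m = (((-1 : ℝ) ^ m : ℝ) : ℂ) := by push_cast; rfl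
  rw [hsgn, Complex.re_ofReal_mul, Complex.re_sum]
  congr 1
  refine Finset.sum_congr rfl fun k _ ↦ ?_
  rw [Complex.re_ofReal_mul]
  ring

/-- Local copy of `im_fourierCoeff_pow_nat` (`WeilFormatCCinfVTable`): **`Im ĉ_m(x^q)` as flat monomials** (`a ≠ 0`, natural `m ≠ 0`). -/
private theorem im_fourierCoeff_pow_nat_loc (ha : a ≠ 0) {m : ℕ} (hm : m ≠ 0) (q : ℕ) :
    (Yoshida1992.fourierCoeff a m (fun x : ℝ ↦ ((x : ℂ)) ^ q)).im
      = (-1 : ℝ) ^ m * ∑ k ∈ Finset.range (q + 1),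
          ((-1 : ℝ) ^ k * (q.descFactorial k : ℝ) * (a ^ (q - k) - (-a) ^ (q - k)) * (a / π) ^ (k + 1)
            * (I ^ (k + 1)).im) / (m : ℝ) ^ (k + 1) := by
  rw [fourierCoeff_pow_nat_loc ha hm q]
  have hsgn : ((-1 : ℂ)) ^ m = (((-1 : ℝ) ^ m : ℝ) : ℂ) := by push_cast; rfl
  rw [hsgn, Complex.im_ofReal_mul, Complex.im_sum]
  congr 1
  refine Finset.sum_congr rfl fun k _ ↦ ?_
  rw [Complex.im_ofReal_mul]
  ring

/-- Local copy of `fourierCoeff_poly` (`WeilFormatCCinfVTable`): linearity of the window coefficient over a real polynomial window (each monomial integrand is continuous). -/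
private theorem fourierCoeff_poly_loc (a : ℝ) (n : ℤ) (s : Finset ℕ) (c : ℕ → ℝ) :
    Yoshida1992.fourierCoeff a n (fun x : ℝ ↦ ∑ q ∈ s, ((c q : ℝ) : ℂ) * ((x : ℂ)) ^ q)
      = ∑ q ∈ s, ((c q : ℝ) : ℂ) * Yoshida1992.fourierCoeff a n (fun x : ℝ ↦ ((x : ℂ)) ^ q) := by
  unfold Yoshida1992.fourierCoeff
  have hint : ∀ q ∈ s, IntervalIntegrable (fun x : ℝ ↦ ((c q : ℝ) : ℂ) * ((x : ℂ)) ^ q * cexp (-(π * I * n * x / a)))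
      MeasureTheory.volume (-a) a := fun q _ ↦
    (Continuous.intervalIntegrable (by fun_prop) _ _)
  rw [← (intervalIntegral.integral_finsetSum hint).symm.trans (intervalIntegral.integral_congr fun x _ ↦ by
    simp only [Finset.sum_mul])]
  refine Finset.sum_congr rfl fun q _ ↦ ?_
  rw [← intervalIntegral.integral_const_mul]
  exact intervalIntegral.integral_congr fun x _ ↦ by ring

/-! ## The low tables -/

/-- **The constant mode of a monomial window**: `ĉ_0(x^q) = ∫_{−a}^{a} x^q dx = (a^{q+1} − (−a)^{q+1})/(q+1)`. -/
theorem fourierCoeff_zero_pow (a : ℝ) (q : ℕ) :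
    Yoshida1992.fourierCoeff a 0 (fun x : ℝ ↦ ((x : ℂ)) ^ q)
      = ((((a ^ (q + 1) - (-a) ^ (q + 1)) / (q + 1) : ℝ)) : ℂ) := by
  unfold Yoshida1992.fourierCoeff
  have e : (fun x : ℝ ↦ ((x : ℂ)) ^ q * cexp (-(π * I * ((0 : ℤ) : ℂ) * x / a)))
      = fun x : ℝ ↦ (((x ^ q : ℝ)) : ℂ) := by
    funext x
    simp only [Int.cast_zero, mul_zero, zero_mul, zero_div, neg_zero, Complex.exp_zero, mul_one,
      Complex.ofReal_pow]
  rw [e, intervalIntegral.integral_ofReal, integral_pow]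

/-- **The even table at the constant mode**: `V⁺_f(0) = (Σ_q c_q (a^{q+1} − (−a)^{q+1})/(q+1))/√(2a)`
(`d_0² = 1`; `a ≥ 0`). -/
theorem evenVTable_zero (ha : 0 ≤ a) (s : Finset ℕ) (c : ℕ → ℝ) :
    (if (0 : ℕ) = 0 then (1 : ℝ) else 2) * (Yoshida1992.fourierCoeff a (0 : ℕ)
        ((Icc (-a) a).indicator fun x : ℝ ↦ ∑ q ∈ s, ((c q : ℝ) : ℂ) * ((x : ℂ)) ^ q)).re / Real.sqrt (2 * a)
      = (∑ q ∈ s, c q * ((a ^ (q + 1) - (-a) ^ (q + 1)) / (q + 1))) / Real.sqrt (2 * a) := by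
  rw [if_pos rfl, one_mul, Nat.cast_zero, fourierCoeff_indicator ha, fourierCoeff_poly_loc, Complex.re_sum]
  congr 1
  refine Finset.sum_congr rfl fun q _ ↦ ?_
  rw [fourierCoeff_zero_pow, ← Complex.ofReal_mul, Complex.ofReal_re]

/-- **The even table at a low nonzero mode** (`a > 0`, `n ≠ 0`), a finite closed form:
`V⁺_f(n) = 2(Σ_q c_q (−1)^n Σ_{k≤q}[(−1)^k q^{(k)}(a^{q−k} − (−a)^{q−k})(a/π)^{k+1}Re(i^{k+1})]/n^{k+1})/√(2a)`. -/
theorem evenVTable_low (ha : 0 < a) {n : ℕ} (hn : n ≠ 0) (s : Finset ℕ) (c : ℕ → ℝ) :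
    (if n = 0 then (1 : ℝ) else 2) * (Yoshida1992.fourierCoeff a n
        ((Icc (-a) a).indicator fun x : ℝ ↦ ∑ q ∈ s, ((c q : ℝ) : ℂ) * ((x : ℂ)) ^ q)).re / Real.sqrt (2 * a)
      = 2 * (∑ q ∈ s, c q * ((-1 : ℝ) ^ n * ∑ k ∈ Finset.range (q + 1),
          ((-1 : ℝ) ^ k * (q.descFactorial k : ℝ) * (a ^ (q - k) - (-a) ^ (q - k)) * (a / π) ^ (k + 1)
            * (I ^ (k + 1)).re) / (n : ℝ) ^ (k + 1))) / Real.sqrt (2 * a) := by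
  rw [if_neg hn, fourierCoeff_indicator ha.le, fourierCoeff_poly_loc, Complex.re_sum]
  congr 2
  refine Finset.sum_congr rfl fun q _ ↦ ?_
  rw [Complex.re_ofReal_mul, re_fourierCoeff_pow_nat_loc ha.ne' hn q]

/-- **The odd table at a low mode** (`a > 0`, kernel index `k`, mode `k+1`):
`V⁻_f(k) = 2(Σ_q c_q (−1)^{k+1} Σ_{l≤q}[(−1)^l q^{(l)}(a^{q−l} − (−a)^{q−l})(a/π)^{l+1}Im(i^{l+1})]/(k+1)^{l+1})/√(2a)`. -/
theorem oddVTable_low (ha : 0 < a) (k : ℕ) (s : Finset ℕ) (c : ℕ → ℝ) :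
    2 * (Yoshida1992.fourierCoeff a ((k : ℤ) + 1)
        ((Icc (-a) a).indicator fun x : ℝ ↦ ∑ q ∈ s, ((c q : ℝ) : ℂ) * ((x : ℂ)) ^ q)).im / Real.sqrt (2 * a)
      = 2 * (∑ q ∈ s, c q * ((-1 : ℝ) ^ (k + 1) * ∑ l ∈ Finset.range (q + 1),
          ((-1 : ℝ) ^ l * (q.descFactorial l : ℝ) * (a ^ (q - l) - (-a) ^ (q - l)) * (a / π) ^ (l + 1)
            * (I ^ (l + 1)).im) / (((k + 1 : ℕ) : ℝ)) ^ (l + 1))) / Real.sqrt (2 * a) := by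
  have e : ((k : ℤ) + 1) = ((k + 1 : ℕ) : ℤ) := by push_cast; ring
  rw [e, fourierCoeff_indicator ha.le, fourierCoeff_poly_loc, Complex.im_sum]
  congr 2
  refine Finset.sum_congr rfl fun q _ ↦ ?_
  rw [Complex.im_ofReal_mul, im_fourierCoeff_pow_nat_loc ha.ne' (Nat.succ_ne_zero k) q]

end Summit.RiemannHypothesis.RiemannHypothesis.Theorems.WeilFormatC
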